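import Summits.Ventures.HSemireg.WedgeHankelRecurrenceHankelBlockTP
import Mathlib.Data.Fin.Tuple.Sort

/-!
# Venture HSemireg — THE DEGENERATE SIDE OF GANTMACHER'S DEFINITION 4: **the infinite Hankel matrix of ANY finite Stieltjes moment sequence `s_p = Σ_j μ_j v_j^p` with masses `μ_j ≥ 0` and
# nodes `v_j > 0` (repetitions and any order allowed, i.e. fewer than `m` effective atoms) is TOTALLY NONNEGATIVE — every minor on increasing rows and columns is `≥ 0`** (each term of (127)
# is `∏ μ · det(v^{r}) · det(v^{c})`, and the product of the two generalised Vandermonde determinants on the same nodes is `≥ 0` whatever the order of the nodes); in Literature's class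
# language every finite section is `IsTN`

HONEST FRAMING. Part of the Lean index of the computation cell `pub-hsemireg` (seat p10 gen 41, Sunday typer «UNIFORM-IN-n»).  Real determinants and finite sums only (N246's (127),
Literature `det_genVandermonde_pos`, `IsTN`; Mathlib `Tuple.sort`); no variety, no cohomology theory, no sheaf, no Ext group and no semiregularity map is constructed here; nothing here says
that HC / HC_CM / HC_AV holds; no Literature fact (unproved `Prop`) is declared or used.  Custodian versions as in `WedgeHankelSiegelIdeal` (1/3).
SOURCES (cited).  F. R. Gantmacher, *The Theory of Matrices* II, Ch. XV §16.2 (127) and Definition 4 (chunks p0201–p0202; the text treats `μ_j > 0`, distinct nodes — the `TP` case, N246 ∕ N247);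
F. R. Gantmacher, M. G. Krein, *Oscillation Matrices and Kernels* (the closure of TP in TN); S. M. Fallat, C. R. Johnson, *Totally Nonnegative Matrices* (2011) §0.0 (`TN`, Literature `IsTN`).
PROOF TYPED HERE.  In (127) (N246 `det_hankelMinor_sum_mul_pow`) a term with a repeated node vanishes (two equal columns); for distinct nodes, sorting them by a permutation `σ` (`Tuple.sort`)
multiplies BOTH generalised Vandermonde determinants by `sign σ`, so their product equals the product for increasing nodes, which is positive (Literature `det_genVandermonde_pos`).
DEDUP DISCLOSURE (`rg -n 'IsTN .*hankel|totally nonnegative' Summits/Ventures/HSemireg`, 2026-09-02): N246 ∕ N247 ∕ N254 (the `TP` case with positive masses and distinct increasing nodes);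
nothing for degenerate data.  The 5 names below: 0 hits tree-wide.

WHAT IS IN THE TREE.  N246 `det_hankelMinor_sum_mul_pow`; Literature `Literature.LinearAlgebra.Matrix.GeneralizedVandermonde.det_genVandermonde_pos`, `Literature.LinearAlgebra.Matrix.IsTN`;
Mathlib `Tuple.sort`, `Tuple.monotone_sort`, `Matrix.det_permute'`, `Matrix.det_permute`, `Matrix.det_zero_of_column_eq`, `Int.units_eq_one_or`.
THIS FILE (namespace `Summit.Ventures.HSemireg.Wedge.HankelOuter` continued; CHAINED on N254; 0 definitions):
* §1025 `det_pow_mul_det_pow_nonneg` (product of the two generalised Vandermonde determinants on the same positive nodes, any order ∕ repetitions, is `≥ 0`),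
  **`det_hankelMinor_sum_mul_pow_nonneg`** (every minor of `(Σ_j μ_j v_j^{i+k})` on increasing rows ∕ columns is `≥ 0` for `μ ≥ 0`, `v > 0`), `det_hankelMinor_nonneg_of_moments`,
  **`isTN_hankelSection_of_moments`** (every finite section is `IsTN`), `isTN_hankelBlock_of_moments`.
CAVEATS.  Nodes equal to `0` (an atom at the origin) are not covered (the column `0^{r_a}` needs a separate expansion).  Nothing Ext-side.  New names only.
-/

open Module Polynomial
open scoped Matrix Polynomial

namespace Summit.Ventures.HSemireg.Wedge.HankelOuter

open Literature.LinearAlgebra.Matrix (IsTN)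

/-! ## §1025. Hankel matrices of nonnegative atomic measures on `(0, ∞)` are totally nonnegative -/

/-- **The product of the two generalised Vandermonde determinants on the same nodes is nonnegative**: for positive nodes `x : Fin h → ℝ` (any order, repetitions allowed) and strictly increasing
exponents `r`, `c`: `0 ≤ det (x_b^{r_a}) · det (x_a^{c_b})`. [mechanism of Gantmacher XV §16 (127)–(128) in the degenerate case; this file, §1025] -/
theorem det_pow_mul_det_pow_nonneg {h : ℕ} {x : Fin h → ℝ} (hx : ∀ b, 0 < x b) {r c : Fin h → ℕ} (hr : StrictMono r) (hc : StrictMono c) :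
    0 ≤ (Matrix.of fun a b : Fin h => x b ^ r a).det * (Matrix.of fun a b : Fin h => x a ^ c b).det := by
  classical
  by_cases hinj : Function.Injective x
  · -- sort the nodes
    set σ : Equiv.Perm (Fin h) := Tuple.sort x with hσ
    have hmono : StrictMono (x ∘ σ) := (Tuple.monotone_sort x).strictMono_of_injective (hinj.comp σ.injective)
    have hA : (Matrix.of fun a b : Fin h => x (σ b) ^ r a).det = Equiv.Perm.sign σ * (Matrix.of fun a b : Fin h => x b ^ r a).det := by
      rw [← Matrix.det_permute' σ]
      rfl
    have hB : (Matrix.of fun a b : Fin h => x (σ a) ^ c b).det = Equiv.Perm.sign σ * (Matrix.of fun a b : Fin h => x a ^ c b).det := by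
      rw [← Matrix.det_permute σ]
      rfl
    have hposA : 0 < (Matrix.of fun a b : Fin h => x (σ b) ^ r a).det :=
      Literature.LinearAlgebra.Matrix.GeneralizedVandermonde.det_genVandermonde_pos h (x ∘ σ) r hmono (fun b => hx _) hr
    have hposB : 0 < (Matrix.of fun a b : Fin h => x (σ a) ^ c b).det := by
      rw [← Matrix.det_transpose]
      exact Literature.LinearAlgebra.Matrix.GeneralizedVandermonde.det_genVandermonde_pos h (x ∘ σ) c hmono (fun b => hx _) hc
    have hprod : (Matrix.of fun a b : Fin h => x (σ b) ^ r a).det * (Matrix.of fun a b : Fin h => x (σ a) ^ c b).det =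
        (Matrix.of fun a b : Fin h => x b ^ r a).det * (Matrix.of fun a b : Fin h => x a ^ c b).det := by
      rw [hA, hB]
      have hs : ((Equiv.Perm.sign σ : ℤˣ) : ℝ) * ((Equiv.Perm.sign σ : ℤˣ) : ℝ) = 1 := by
        rcases Int.units_eq_one_or (Equiv.Perm.sign σ) with h1 | h1 <;> simp [h1]
      linear_combination ((Matrix.of fun a b : Fin h => x b ^ r a).det * (Matrix.of fun a b : Fin h => x a ^ c b).det) * hs
    rw [← hprod]
    exact (mul_pos hposA hposB).le
  · -- a repeated node: two equal columns
    obtain ⟨b, b', hbb, hne⟩ : ∃ b b', x b = x b' ∧ b ≠ b' := by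
      simpa [Function.Injective, not_forall] using hinj
    rw [Matrix.det_zero_of_column_eq hne (fun a => by simp [Matrix.of_apply, hbb]), zero_mul]

/-- **Every minor of the Hankel matrix of a nonnegative combination of positive geometric sequences is `≥ 0`**: for `μ_j ≥ 0`, `v_j > 0` (any `m`, any order, repetitions allowed) and strictly
increasing rows `r` and columns `c`, `0 ≤ det (Σ_j μ_j v_j^{r_a + c_b})_{a,b}`. [Gantmacher XV §16 (127) with nonnegative terms; this file, §1025] -/
theorem det_hankelMinor_sum_mul_pow_nonneg {m h : ℕ} {μ v : Fin m → ℝ} (hμ : ∀ j, 0 ≤ μ j) (hv : ∀ j, 0 < v j) {r c : Fin h → ℕ} (hr : StrictMono r) (hc : StrictMono c) :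
    0 ≤ (Matrix.of fun a b : Fin h => ∑ j, μ j * v j ^ (r a + c b)).det := by
  rw [det_hankelMinor_sum_mul_pow]
  refine Finset.sum_nonneg fun S _ => ?_
  exact mul_nonneg (Finset.prod_nonneg fun a _ => hμ _) (det_pow_mul_det_pow_nonneg (x := fun b => v (Set.powersetCard.ofFinEmbEquiv.symm S b)) (fun b => hv _) hr hc)

/-- The same for a sequence given by its moments `s_p = Σ_j μ_j v_j^p`. [this file, §1025] -/
theorem det_hankelMinor_nonneg_of_moments {m h : ℕ} {s : ℕ → ℝ} {μ v : Fin m → ℝ} (hμ : ∀ j, 0 ≤ μ j) (hv : ∀ j, 0 < v j) (hs : ∀ p, s p = ∑ j, μ j * v j ^ p)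
    {r c : Fin h → ℕ} (hr : StrictMono r) (hc : StrictMono c) : 0 ≤ (Matrix.of fun a b : Fin h => s (r a + c b)).det := by
  have hmat : (Matrix.of fun a b : Fin h => s (r a + c b)) = Matrix.of fun a b : Fin h => ∑ j, μ j * v j ^ (r a + c b) := by
    ext a b
    simp only [Matrix.of_apply, hs]
  rw [hmat]
  exact det_hankelMinor_sum_mul_pow_nonneg hμ hv hr hc

/-- **Every finite section `(s_{i+k})_{i<p, k<q}` of the Hankel matrix of a nonnegative atomic measure on `(0, ∞)` is TOTALLY NONNEGATIVE (`IsTN`).**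
[Gantmacher XV §16 Def 4, degenerate case; Fallat–Johnson §0.0 `TN`; this file, §1025] -/
theorem isTN_hankelSection_of_moments {m : ℕ} {s : ℕ → ℝ} {μ v : Fin m → ℝ} (hμ : ∀ j, 0 ≤ μ j) (hv : ∀ j, 0 < v j) (hs : ∀ p, s p = ∑ j, μ j * v j ^ p) (p q : ℕ) :
    IsTN (Matrix.of fun (i : Fin p) (k : Fin q) => s ((i : ℕ) + (k : ℕ))) := by
  intro j r c hr hc
  have hmat : (Matrix.of fun (i : Fin p) (k : Fin q) => s ((i : ℕ) + (k : ℕ))).submatrix r c = Matrix.of fun a b : Fin j => s ((fun a => (r a : ℕ)) a + (fun b => (c b : ℕ)) b) := by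
    ext a b
    simp only [Matrix.submatrix_apply, Matrix.of_apply]
  rw [hmat]
  exact det_hankelMinor_nonneg_of_moments hμ hv hs (fun a b hab => hr hab) (fun a b hab => hc hab)

/-- In particular the `(t+1) × (t+2)` block (132) of such a sequence is `IsTN` (the closure of the domain of stability in the Markov parameters consists of TN blocks).
[this file, §1025] -/
theorem isTN_hankelBlock_of_moments {m t : ℕ} {s : ℕ → ℝ} {μ v : Fin m → ℝ} (hμ : ∀ j, 0 ≤ μ j) (hv : ∀ j, 0 < v j) (hs : ∀ p, s p = ∑ j, μ j * v j ^ p) :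
    IsTN (Matrix.of fun (i : Fin (t + 1)) (k : Fin (t + 2)) => s ((i : ℕ) + (k : ℕ))) :=
  isTN_hankelSection_of_moments hμ hv hs (t + 1) (t + 2)

end Summit.Ventures.HSemireg.Wedge.HankelOuter
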